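import Summits.QuantumFields.BalabanUV.Beta.FP.HorizontalEndMean

/-!
# `BalabanUV.Beta.FP.HorizontalEndMeanNat` — road «FP» for binder row D1, row H′5-MEAN (owner ruling R-FP-19,
# `HOME/b2b-balaban-beta-d1-p3/OWNER-RULINGS-FP-5.md` v1.2): THE SOCKETS OF THE OWNER's MEAN END `FP/HorizontalEndMean` —
# the INTEGER window (the shape H3-BOOK's `N : ℕ` ENDs and `FP/HorizontalGerm`'s `M : ℕ` deliver), the DEFECT form (the literal mean-law
# binder `hasym` of the road's END theorems), and the O(1) ⟹ MEAN downgrade of the GERM letter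

HONEST DEPENDENCY (page 1, mandatory): continuum YM on T⁴ ⇐ BetaPertH ∧ nine spine estimates (0/9 proved); BetaPertH ⇐ (D1) ∧ (D4) ∧
CAP+tail; G-an2-4 gates asym, D1 and NE2/3/4.  HONEST FRAMING (cell contract, verbatim): «discharging `BetaPertH` makes Bałaban's UV
stability UNCONDITIONAL — a real constructive-QFT result; it is NOT the continuum limit and NOT the Clay problem.»  THIS MODULE DISCHARGES
NOTHING of the wall: [folklore] real analysis (composition of limits + `Real.log_pow`; Mathlib + the owner's `FP/HorizontalEndMean`); every
analytic input is a HYPOTHESIS with its supplier named; no `def`, no `def … : Prop`, no cited fact, 0 sorry; 0 wall binders; NOT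
`hasym`-discharged, NOT D1, NOT BetaPertH, NOT continuum, NOT Clay.

ABSOLUTE RULE (cell charter, verbatim): «No internally-minted statement may enter as a cited fact. Every hypothesis is either kernel-proved in
this package or a verbatim quotation of a PUBLISHED theorem with page reference. The manuscript(s) under audit are NOT citable for their own
disputed steps — they are the thing under adjudication; programme-internal (2001/route/tribunal) claims are never citable.»

WHAT (same letters as `FP/HorizontalEnd` ∕ `FP/HorizontalEndMean`: `f m` = the perfect `m`-fold coefficient, the one shot at blocking `n = L^m`;
`g` = the WINDOWED second moment of `Π^{BF}`; `s` = the slope):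
* §1 three limit lemmas: `tendsto_sub_mul_div_iff` (DEFECT form `(f m − m·c)/m → 0` ↔ SLOPE form `f m / m → c`), `tendsto_window_pow_div`
  (`g M / log M → s` along `ℕ` ⟹ `g (L^m) / m → s·log L` for EVERY `L : ℕ` — no `2 ≤ L`: for `L ≤ 1` the window is constant and `log L = 0`),
  `tendsto_div_of_abs_sub_le` (along any filter: `lg → ∞` and eventually `|g − (s·lg + c₀)| ≤ C` ⟹ `g / lg → s`);
* §2 THE MEAN END WITH AN INTEGER WINDOW (`g : ℕ → ℝ`, `hgerm : g M / log M → s` as `M → ∞` in `ℕ`): `tendsto_div_of_horizontal_mean_nat`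
  (slope form), `hasym_mean_of_horizontal_nat` (defect form), `hasym_mean_of_horizontal_nat_stepBal` — at `s := 11N²/(12π²)` the conclusion is
  VERBATIM the mean-law binder `hasym : Tendsto (fun m ↦ (f m − m·stepBal N Lc)/m) atTop (𝓝 0)` of
  `FP/PerfectObjectsT.d1Drift_JsBalOf_of_perfect_step_law_littleO` ∕ `FP/RoadEndGeneric.d1Drift_of_generic_step_law_littleO`;
  `value_of_step_law_of_tendsto_div` + `value_of_horizontal_mean_step_nat[_stepBal]` ((STEP) ⟹ `f 1 = s·log L` EXACTLY);
* §3 THE REAL-WINDOW END IN DEFECT FORM: `hasym_mean_of_horizontal_stepBal` — the owner's `tendsto_div_of_horizontal_mean_stepBal` (slope form,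
  `2 ≤ Lc`) rewritten as the END's literal `hasym`;
* §4 O(1) ⟹ MEAN FOR THE GERM LETTER (the owner's `tendsto_div_natCast_of_bounded` does the bookkeeping letter): `hgerm_mean_of_bounded`
  (`|g R − (s·log R + c₀)| ≤ C` for `R ≥ 1` ⟹ `g R / log R → s`), `hgerm_mean_of_bounded_nat`; junction `hasym_mean_of_horizontal_bounded_nat`:
  the letters of `FP/HorizontalEndNat.hasym_of_horizontal_nat` give the MEAN END's conclusion (the O(1) END is the STRETCH target, R-FP-19 (a)).
Provenance: D1 formalisation swarm, unit b2b-balaban-beta-d1-formalise-leaf-05 gen 9 (prover-b2b-balaban-beta-d1-formalise-leaf-05-g9-0),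
2026-08-20; row H′5-MEAN of `HOME/b2b-balaban-beta-d1-p3/LEAVES-FP.md` (owner's END p234645; this file = its ℕ-window ∕ defect-form sockets).
[folklore], 0 def, 0 cite, 0 sorry.
-/

namespace Summit.QuantumFields.BalabanUV.Beta.FP.HorizontalEndMeanNat

open Filter Topology
open Literature.MathematicalPhysics.QuantumFieldTheory.Balaban1983to89
open B12Normalization (stepBal stepBal_eq)
open Summit.QuantumFields.BalabanUV.Beta.FP.HorizontalEndMean (tendsto_div_of_horizontal_mean_stepBal tendsto_div_natCast_of_bounded)

/-! ## §1 Three limit lemmas -/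

/-- [folklore] **DEFECT FORM ↔ SLOPE FORM**: `(f m − m·c)/m → 0` iff `f m / m → c` (the two differ by the constant `c` from `m = 1` on). -/
theorem tendsto_sub_mul_div_iff {f : ℕ → ℝ} {c : ℝ} :
    Tendsto (fun m : ℕ => (f m - (m : ℝ) * c) / (m : ℝ)) atTop (𝓝 0) ↔ Tendsto (fun m : ℕ => f m / (m : ℝ)) atTop (𝓝 c) := by
  have hev : (fun m : ℕ => (f m - (m : ℝ) * c) / (m : ℝ)) =ᶠ[atTop] fun m : ℕ => f m / (m : ℝ) - c := by
    filter_upwards [eventually_ne_atTop 0] with m hm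
    have hm' : (m : ℝ) ≠ 0 := Nat.cast_ne_zero.mpr hm
    field_simp
  rw [tendsto_congr' hev]
  exact tendsto_sub_nhds_zero_iff

/-- [folklore] **THE WINDOWED GERM ALONG THE GEOMETRIC WINDOW**: if `g M / log M → s` as `M → ∞` in `ℕ`, then `g (L^m) / m → s·log L` for
EVERY `L : ℕ` (for `1 < L` by composition with `L^m → ∞` and `log (L^m) = m·log L`; for `L ≤ 1` the window `L^m` is constant from `m = 1` on
and `log L = 0`, so both sides vanish and `hgerm` is not used). -/
theorem tendsto_window_pow_div {g : ℕ → ℝ} {s : ℝ} (L : ℕ)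
    (hgerm : Tendsto (fun M : ℕ => g M / Real.log M) atTop (𝓝 s)) :
    Tendsto (fun m : ℕ => g (L ^ m) / (m : ℝ)) atTop (𝓝 (s * Real.log L)) := by
  rcases le_or_gt L 1 with hL | hL
  · interval_cases L
    · simp only [Nat.cast_zero, Real.log_zero, mul_zero]
      refine (tendsto_const_div_atTop_nhds_zero_nat (g 0)).congr' ?_
      filter_upwards [eventually_ge_atTop 1] with m hm
      rw [zero_pow (by omega)]
    · simp only [Nat.cast_one, Real.log_one, mul_zero, one_pow]
      exact tendsto_const_div_atTop_nhds_zero_nat (g 1)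
  · have hL1 : (1 : ℝ) < (L : ℝ) := by exact_mod_cast hL
    have hlog0 : Real.log (L : ℝ) ≠ 0 := (Real.log_pos hL1).ne'
    have hpow : Tendsto (fun m : ℕ => L ^ m) atTop atTop := tendsto_pow_atTop_atTop_of_one_lt hL
    have h1 : Tendsto (fun m : ℕ => g (L ^ m) / Real.log ((L ^ m : ℕ) : ℝ)) atTop (𝓝 s) := hgerm.comp hpow
    have h2 : Tendsto (fun m : ℕ => g (L ^ m) / Real.log ((L ^ m : ℕ) : ℝ) * Real.log (L : ℝ)) atTop
        (𝓝 (s * Real.log L)) := h1.mul_const _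
    refine h2.congr' ?_
    filter_upwards [eventually_ne_atTop 0] with m hm
    have hm' : (m : ℝ) ≠ 0 := Nat.cast_ne_zero.mpr hm
    push_cast
    rw [Real.log_pow]
    field_simp

/-- [folklore] **BOUNDED GERM DEFECT ⟹ MEAN GERM, ABSTRACT**: along any filter `l`, if `lg → +∞` and eventually `|g i − (s·lg i + c₀)| ≤ C`,
then `g i / lg i → s`. -/
theorem tendsto_div_of_abs_sub_le {ι : Type*} {l : Filter ι} {g lg : ι → ℝ} {s c₀ C : ℝ}
    (hlg : Tendsto lg l atTop) (hgerm : ∀ᶠ i in l, |g i - (s * lg i + c₀)| ≤ C) :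
    Tendsto (fun i => g i / lg i) l (𝓝 s) := by
  have h0 : Tendsto (fun i => (C + |c₀|) / lg i) l (𝓝 0) := tendsto_const_nhds.div_atTop hlg
  refine tendsto_sub_nhds_zero_iff.mp (squeeze_zero_norm' ?_ h0)
  filter_upwards [hgerm, hlg.eventually_ge_atTop 1] with i hi hi1
  have hpos : 0 < lg i := by linarith
  have key : g i / lg i - s = ((g i - (s * lg i + c₀)) + c₀) / lg i := by
    field_simp
    ring
  rw [key, Real.norm_eq_abs, abs_div, abs_of_pos hpos]
  exact div_le_div_of_nonneg_right ((abs_add_le _ _).trans (by linarith)) hpos.le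

/-! ## §2 THE MEAN END WITH AN INTEGER WINDOW -/

/-- [folklore] **THE MEAN END, INTEGER WINDOW, SLOPE FORM**: `(f m − g(L^m))/m → 0` and `g M / log M → s` (`g : ℕ → ℝ`, `M → ∞` in `ℕ`)
⟹ `f m / m → s·log L`.  No hypothesis on `L`. -/
theorem tendsto_div_of_horizontal_mean_nat {f g : ℕ → ℝ} {s : ℝ} {L : ℕ}
    (hbook : Tendsto (fun m : ℕ => (f m - g (L ^ m)) / (m : ℝ)) atTop (𝓝 0))
    (hgerm : Tendsto (fun M : ℕ => g M / Real.log M) atTop (𝓝 s)) :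
    Tendsto (fun m : ℕ => f m / (m : ℝ)) atTop (𝓝 (s * Real.log L)) := by
  have h := hbook.add (tendsto_window_pow_div L hgerm)
  rw [zero_add] at h
  refine h.congr' ?_
  filter_upwards [eventually_ne_atTop 0] with m hm
  have hm' : (m : ℝ) ≠ 0 := Nat.cast_ne_zero.mpr hm
  field_simp
  ring

/-- [folklore] **THE MEAN END, INTEGER WINDOW, DEFECT FORM**: same letters ⟹ `(f m − m·(s·log L))/m → 0`. -/
theorem hasym_mean_of_horizontal_nat {f g : ℕ → ℝ} {s : ℝ} {L : ℕ}
    (hbook : Tendsto (fun m : ℕ => (f m - g (L ^ m)) / (m : ℝ)) atTop (𝓝 0))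
    (hgerm : Tendsto (fun M : ℕ => g M / Real.log M) atTop (𝓝 s)) :
    Tendsto (fun m : ℕ => (f m - (m : ℝ) * (s * Real.log L)) / (m : ℝ)) atTop (𝓝 0) :=
  tendsto_sub_mul_div_iff.mpr (tendsto_div_of_horizontal_mean_nat hbook hgerm)

/-- [folklore] **THE MEAN END, INTEGER WINDOW, IN THE CELL's CURRENCY**: with the slope `s := 11N²/(12π²)` the conclusion is road FP's mean-law
binder `hasym : Tendsto (fun m ↦ (f m − m·stepBal N Lc)/m) atTop (𝓝 0)` — VERBATIM the `hasym` of
`FP/PerfectObjectsT.d1Drift_JsBalOf_of_perfect_step_law_littleO` and of `FP/RoadEndGeneric.d1Drift_of_generic_step_law_littleO`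
(`B12Normalization.stepBal_eq`: `stepBal N L = (11N²/(12π²))·log L`). -/
theorem hasym_mean_of_horizontal_nat_stepBal {f g : ℕ → ℝ} (N : ℝ) {Lc : ℕ}
    (hbook : Tendsto (fun m : ℕ => (f m - g (Lc ^ m)) / (m : ℝ)) atTop (𝓝 0))
    (hgerm : Tendsto (fun M : ℕ => g M / Real.log M) atTop (𝓝 (11 * N ^ 2 / (12 * Real.pi ^ 2)))) :
    Tendsto (fun m : ℕ => (f m - (m : ℝ) * stepBal N Lc) / (m : ℝ)) atTop (𝓝 0) := by
  simp only [stepBal_eq]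
  exact hasym_mean_of_horizontal_nat hbook hgerm

/-- [folklore] **(STEP) + SLOPE ⟹ VALUE**: if `f (m+1) = f m + f 1` for `m ≥ 1` and `f m / m → c`, then `f 1 = c` — `f m = m·f 1`, so the slope
sequence is the CONSTANT `f 1` from `m = 1` on («uniqueness does the identification»). -/
theorem value_of_step_law_of_tendsto_div {f : ℕ → ℝ} {c : ℝ} (hstep : ∀ m : ℕ, 1 ≤ m → f (m + 1) = f m + f 1)
    (hslope : Tendsto (fun m : ℕ => f m / (m : ℝ)) atTop (𝓝 c)) : f 1 = c := by
  have hpow : ∀ m : ℕ, 1 ≤ m → f m = (m : ℝ) * f 1 := by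
    intro m hm
    induction m with
    | zero => omega
    | succ k ih =>
      rcases Nat.eq_zero_or_pos k with hk | hk
      · subst hk; simp
      · rw [hstep k hk, ih hk]; push_cast; ring
  have hconst : Tendsto (fun m : ℕ => f m / (m : ℝ)) atTop (𝓝 (f 1)) := by
    refine (tendsto_const_nhds (x := f 1)).congr' ?_
    filter_upwards [eventually_ge_atTop 1] with m hm
    have hm0 : (m : ℝ) ≠ 0 := by exact_mod_cast (by omega : m ≠ 0)
    rw [hpow m hm]
    field_simp
  exact tendsto_nhds_unique hconst hslope

/-- [folklore] **EXACTNESS FROM (STEP), INTEGER WINDOW**: `(f m − g(L^m))/m → 0`, `g M / log M → s`, `f (m+1) = f m + f 1` (`m ≥ 1`)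
⟹ `f 1 = s·log L`. -/
theorem value_of_horizontal_mean_step_nat {f g : ℕ → ℝ} {s : ℝ} {L : ℕ}
    (hbook : Tendsto (fun m : ℕ => (f m - g (L ^ m)) / (m : ℝ)) atTop (𝓝 0))
    (hgerm : Tendsto (fun M : ℕ => g M / Real.log M) atTop (𝓝 s))
    (hstep : ∀ m : ℕ, 1 ≤ m → f (m + 1) = f m + f 1) :
    f 1 = s * Real.log L :=
  value_of_step_law_of_tendsto_div hstep (tendsto_div_of_horizontal_mean_nat hbook hgerm)

/-- [folklore] The cell's currency, integer window: (STEP) + the mean horizontal route ⟹ `f 1 = stepBal N Lc`. -/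
theorem value_of_horizontal_mean_step_nat_stepBal {f g : ℕ → ℝ} (N : ℝ) {Lc : ℕ}
    (hbook : Tendsto (fun m : ℕ => (f m - g (Lc ^ m)) / (m : ℝ)) atTop (𝓝 0))
    (hgerm : Tendsto (fun M : ℕ => g M / Real.log M) atTop (𝓝 (11 * N ^ 2 / (12 * Real.pi ^ 2))))
    (hstep : ∀ m : ℕ, 1 ≤ m → f (m + 1) = f m + f 1) :
    f 1 = stepBal N Lc := by
  rw [stepBal_eq]
  exact value_of_horizontal_mean_step_nat hbook hgerm hstep

/-! ## §3 THE REAL-WINDOW END IN DEFECT FORM -/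

/-- [folklore] **THE OWNER's MEAN END AS THE END's LITERAL BINDER**: the letters of `FP/HorizontalEndMean.tendsto_div_of_horizontal_mean_stepBal`
(`2 ≤ Lc`, real window) give `hasym : Tendsto (fun m ↦ (f m − m·stepBal N Lc)/m) atTop (𝓝 0)` — the mean-law `hasym` of the road's END theorems, verbatim. -/
theorem hasym_mean_of_horizontal_stepBal {f : ℕ → ℝ} {g : ℝ → ℝ} (N : ℝ) {Lc : ℕ} (hLc : 2 ≤ Lc)
    (hbook : Tendsto (fun m : ℕ => (f m - g ((Lc : ℝ) ^ m)) / (m : ℝ)) atTop (𝓝 0))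
    (hgerm : Tendsto (fun R : ℝ => g R / Real.log R) atTop (𝓝 (11 * N ^ 2 / (12 * Real.pi ^ 2)))) :
    Tendsto (fun m : ℕ => (f m - (m : ℝ) * stepBal N Lc) / (m : ℝ)) atTop (𝓝 0) :=
  tendsto_sub_mul_div_iff.mpr (tendsto_div_of_horizontal_mean_stepBal N hLc hbook hgerm)

/-- [folklore] A real window restricts to an integer window: `g R / log R → s` along `ℝ` gives `g M / log M → s` along `ℕ`, and the
bookkeeping letter rewrites by `((L:ℝ)^m) = ((L^m : ℕ) : ℝ)` — so §2 (no `2 ≤ L`) also serves the real-window letters. -/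
theorem hasym_mean_of_horizontal_real {f : ℕ → ℝ} {g : ℝ → ℝ} {s : ℝ} {L : ℕ}
    (hbook : Tendsto (fun m : ℕ => (f m - g ((L : ℝ) ^ m)) / (m : ℝ)) atTop (𝓝 0))
    (hgerm : Tendsto (fun R : ℝ => g R / Real.log R) atTop (𝓝 s)) :
    Tendsto (fun m : ℕ => (f m - (m : ℝ) * (s * Real.log L)) / (m : ℝ)) atTop (𝓝 0) := by
  have hgermN : Tendsto (fun M : ℕ => g M / Real.log M) atTop (𝓝 s) := hgerm.comp tendsto_natCast_atTop_atTop
  have hbookN : Tendsto (fun m : ℕ => (f m - g ((L ^ m : ℕ) : ℝ)) / (m : ℝ)) atTop (𝓝 0) := by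
    simpa only [Nat.cast_pow] using hbook
  exact hasym_mean_of_horizontal_nat hbookN hgermN

/-! ## §4 O(1) ⟹ MEAN for the germ letter, and the junction with `FP/HorizontalEndNat` -/

/-- [folklore] **O(1) GERM ⟹ MEAN GERM, REAL WINDOW**: `|g R − (s·log R + c₀)| ≤ C` for `R ≥ 1` (the `hgerm` of `FP/HorizontalEnd`) gives
`g R / log R → s`. -/
theorem hgerm_mean_of_bounded {g : ℝ → ℝ} {s c₀ C : ℝ} (hgerm : ∀ R : ℝ, 1 ≤ R → |g R - (s * Real.log R + c₀)| ≤ C) :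
    Tendsto (fun R : ℝ => g R / Real.log R) atTop (𝓝 s) :=
  tendsto_div_of_abs_sub_le Real.tendsto_log_atTop (by
    filter_upwards [eventually_ge_atTop (1 : ℝ)] with R hR using hgerm R hR)

/-- [folklore] **O(1) GERM ⟹ MEAN GERM, INTEGER WINDOW** (the `hgerm` of `FP/HorizontalEndNat`). -/
theorem hgerm_mean_of_bounded_nat {g : ℕ → ℝ} {s c₀ C : ℝ} (hgerm : ∀ M : ℕ, 1 ≤ M → |g M - (s * Real.log M + c₀)| ≤ C) :
    Tendsto (fun M : ℕ => g M / Real.log M) atTop (𝓝 s) :=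
  tendsto_div_of_abs_sub_le (Real.tendsto_log_atTop.comp tendsto_natCast_atTop_atTop) (by
    filter_upwards [eventually_ge_atTop 1] with M hM using hgerm M hM)

/-- [folklore] **JUNCTION — THE O(1) END's LETTERS GIVE THE MEAN END's CONCLUSION** (integer window; same letters as
`FP/HorizontalEndNat.hasym_of_horizontal_nat`, weaker conclusion: the O(1) form is the STRETCH target, the mean form the BINDING one, R-FP-19 (a)). -/
theorem hasym_mean_of_horizontal_bounded_nat {f g : ℕ → ℝ} {s U c₀ C : ℝ} {L : ℕ}
    (hbook : ∀ m : ℕ, 1 ≤ m → |f m - g (L ^ m)| ≤ U)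
    (hgerm : ∀ M : ℕ, 1 ≤ M → |g M - (s * Real.log M + c₀)| ≤ C) :
    Tendsto (fun m : ℕ => (f m - (m : ℝ) * (s * Real.log L)) / (m : ℝ)) atTop (𝓝 0) :=
  hasym_mean_of_horizontal_nat (tendsto_div_natCast_of_bounded (h := fun m => f m - g (L ^ m)) hbook)
    (hgerm_mean_of_bounded_nat hgerm)

end Summit.QuantumFields.BalabanUV.Beta.FP.HorizontalEndMeanNat
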